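import Literature.MathematicalPhysics.QuantumLattice.FreeFermionSectorGroundStates
import Literature.MathematicalPhysics.QuantumLattice.PairedProductStatesInteraction
import Literature.MathematicalPhysics.QuantumLattice.HubbardPairDensityCouplingFloor
import HarnessLib

/-!
# Kinetic excess and doublon density of sector ground states of the repulsive Hubbard torus

Family `hubbard` / trunk T-QLATTICE. The Hartree–Fock energy of the paramagnetic paired Fermi sea
(`re_expect_interaction_pairedState`: doublon density exactly `n²/L²`) as the variational competitor of an
arbitrary ground state `ψ` of the `(2n, S^z = 0)` sector of `hubbardTorus 2 L 1 U`, `U ≥ 0`, `L ≥ 3`: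
`⟨ψ, H₀ψ⟩ + U⟨ψ, Dψ⟩ = E₀(U) ≤ E₀(0) + U n²/L²`, with `⟨ψ, H₀ψ⟩ ≥ E₀(0)` and `⟨ψ, Dψ⟩ ≥ 0`. Hence

* `re_expect_hubbardTorus_pairedFermiSea` — the energy of the paired sea over a Fermi set is
  `E₀(0) + U n²/L²` (`minEnergyOn_szSector_free_eq`);
* `kineticExcess_le_of_groundStateInSector` — **`Re⟨ψ, H₀ψ⟩ - E₀(0) ≤ U n²/L²`**: every sector ground
  state has free kinetic energy within `U n²/L² ≤ U ν² L²` of the free sector minimum (sharpening the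
  `U L²` of `re_expect_hubbardTorus_zero_le_of_groundStateInSector` by the factor `ν² ≤ 1/4`);
* `re_expect_interaction_le_of_groundStateInSector` — **`Re⟨ψ, Σ_x n_x↑ n_x↓ ψ⟩ ≤ n²/L²` for `U > 0`**:
  repulsion never raises the doublon density of a sector ground state above the uncorrelated value
  `(n/L²)² L²` (versus the `8n/U` of `hubbardTorus_groundState_doublon_le`, better for `U > 8/ν`);
* `sum_abs_sub_fermiLevel_mul_le_of_groundStateInSector` — with `sum_abs_sub_fermiLevel_mul_le_energy_excess`:
  **`Σ_k |ε_L(k) - ε_F| x_k(1 - x_k) ≤ U n²/L²`**, `x_k = Re⟨ψ, n_{k↑}ψ⟩`: the Bloch occupations of every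
  normalised sector ground state deviate from the Fermi step only in an energy shell of weight `U ν² L²`
  (the one-body input of any weak-coupling control of ground-state correlations).

Sources: D. R. Penn, Phys. Rev. 142 (1966) 350, §II (paramagnetic Hartree–Fock energy); H. Tasaki,
*Physics and Mathematics of Quantum Many-Body Systems* (2020) §2.2 (variational principle);
J. Bardeen, L. N. Cooper, J. R. Schrieffer, Phys. Rev. 108 (1957) 1175, §II. Folklore; no named facts, no
definitions, no sorry.
-/

noncomputable section

namespace Literature.MathematicalPhysics.QuantumLattice

open Matrix Finset Literature.Probability.LatticeModels
open scoped ComplexOrder ComplexConjugate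

variable {L : ℕ} [NeZero L]

/-- **The paired Fermi sea over a Fermi set has energy `E₀(0) + U n²/L²`**: for `L ≥ 3`, a Fermi set `F`
(`ε ≤ ε_F` on `F`, `ε_F ≤ ε` off `F`) and any real `U`,
`Re⟨Φ_F, H(U) Φ_F⟩ = minEnergyOn H₀ (szSector (2|F|) 0) + U |F|²/L²`. Penn (1966) §II. [folklore] -/
theorem re_expect_hubbardTorus_pairedFermiSea (hL : 3 ≤ L) (U : ℝ) (F : Finset (TorusSite 2 L)) (eF : ℝ)
    (hF : ∀ k ∈ F, torusBand L k ≤ eF) (hF' : ∀ k ∉ F, eF ≤ torusBand L k) :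
    (star ((List.map (fun q : TorusSite 2 L => (pairMode q)ᴴ) F.toList).prod *ᵥ
        (vacuum : Fock (Orb (FermionTorus 2 L)))) ⬝ᵥ
      (hubbardTorus 2 L 1 U *ᵥ ((List.map (fun q : TorusSite 2 L => (pairMode q)ᴴ) F.toList).prod *ᵥ
        (vacuum : Fock (Orb (FermionTorus 2 L)))))).re =
      (hubbardTorus 2 L 1 0).minEnergyOn (szSector (Λ := FermionTorus 2 L) (2 * F.card) 0) +
        U * ((F.card : ℝ) ^ 2 / (L : ℝ) ^ 2) := by
  classical
  rw [hubbardTorus_eq_zero_add_smul_interaction U, add_mulVec, Matrix.smul_mulVec, dotProduct_add,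
    dotProduct_smul, smul_eq_mul, Complex.add_re, Complex.re_ofReal_mul,
    re_expect_hubbardTorus_zero_pairedState hL F.nodup_toList, re_expect_interaction_pairedState F.nodup_toList,
    Finset.length_toList, Finset.toList_toFinset, minEnergyOn_szSector_free_eq hL F eF hF hF']

/-- The two variational inequalities behind the file: for `U ≥ 0`, `L ≥ 3` and a normalised ground state
`ψ` of the `(2n, S^z = 0)` sector of `hubbardTorus 2 L 1 U`,
`Re⟨ψ, H₀ψ⟩ + U Re⟨ψ, Dψ⟩ ≤ minEnergyOn H₀ (szSector (2n) 0) + U n²/L²` and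
`minEnergyOn H₀ (szSector (2n) 0) ≤ Re⟨ψ, H₀ψ⟩`. [folklore] -/
theorem re_expect_add_interaction_le_of_groundStateInSector (hL : 3 ≤ L) {U : ℝ} {n : ℕ}
    {ψ : Fock (Orb (FermionTorus 2 L))} (hψ : IsGroundStateInSector (hubbardTorus 2 L 1 U) (2 * n) 0 ψ)
    (h1 : star ψ ⬝ᵥ ψ = 1) :
    (star ψ ⬝ᵥ (hubbardTorus 2 L 1 0 *ᵥ ψ)).re +
        U * (star ψ ⬝ᵥ ((∑ x : FermionTorus 2 L, numberOp x 0 * numberOp x 1 :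
          Matrix (Finset (Orb (FermionTorus 2 L))) _ ℂ) *ᵥ ψ)).re ≤
      (hubbardTorus 2 L 1 0).minEnergyOn (szSector (Λ := FermionTorus 2 L) (2 * n) 0) +
        U * ((n : ℝ) ^ 2 / (L : ℝ) ^ 2) ∧
    (hubbardTorus 2 L 1 0).minEnergyOn (szSector (Λ := FermionTorus 2 L) (2 * n) 0) ≤
      (star ψ ⬝ᵥ (hubbardTorus 2 L 1 0 *ᵥ ψ)).re := by
  classical
  obtain ⟨hmem, hne, hHψ⟩ := hψ
  have hsec : IsInSector n n ψ := (mem_szSector_two_mul_zero_iff n ψ).1 hmem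
  -- `n ≤ L²`: the support of `ψ` has an `n`-element `↑`-part
  obtain ⟨s, hs⟩ := Function.ne_iff.1 hne
  have hns : (upPart s).card = n := (not_imp_comm.1 (hsec s) hs).1
  have hn : n ≤ Fintype.card (TorusSite 2 L) := by
    rw [card_torusSite, ← hns]
    calc (upPart s).card ≤ (Finset.univ : Finset (FermionTorus 2 L)).card := Finset.card_le_univ _
      _ = L ^ 2 := by simp
  obtain ⟨F, eF, hFc, hF, hF'⟩ := exists_fermiSet (torusBand L) hn
  -- the competitor `Φ_F`
  set Φ : Fock (Orb (FermionTorus 2 L)) :=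
    (List.map (fun q : TorusSite 2 L => (pairMode q)ᴴ) F.toList).prod *ᵥ
      (vacuum : Fock (Orb (FermionTorus 2 L))) with hΦ_def
  have hΦmem : Φ ∈ szSector (Λ := FermionTorus 2 L) (2 * n) 0 := by
    have h := pairedState_mem_szSector (L := L) F.toList
    rwa [Finset.length_toList, hFc] at h
  have hΦ1 : star Φ ⬝ᵥ Φ = 1 := star_pairedState_dotProduct_self F.nodup_toList
  have hHU : (hubbardTorus 2 L 1 U).IsHermitian := LiebThm1.hamiltonian_isHermitian _ 1 U
  have hvar := minEnergyOn_le_rayleigh_of_mem hHU _ hΦmem hΦ1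
  rw [hΦ_def, re_expect_hubbardTorus_pairedFermiSea hL U F eF hF hF', hFc] at hvar
  -- `⟨ψ, H(U)ψ⟩ = E₀(U)` and the split `H(U) = H₀ + U D`
  have hE : (star ψ ⬝ᵥ (hubbardTorus 2 L 1 U *ᵥ ψ)).re =
      (hubbardTorus 2 L 1 U).minEnergyOn (szSector (Λ := FermionTorus 2 L) (2 * n) 0) := by
    rw [hHψ, dotProduct_smul, smul_eq_mul, h1, mul_one, Complex.ofReal_re]
  have hsplit : (star ψ ⬝ᵥ (hubbardTorus 2 L 1 U *ᵥ ψ)).re =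
      (star ψ ⬝ᵥ (hubbardTorus 2 L 1 0 *ᵥ ψ)).re +
        U * (star ψ ⬝ᵥ ((∑ x : FermionTorus 2 L, numberOp x 0 * numberOp x 1 :
          Matrix (Finset (Orb (FermionTorus 2 L))) _ ℂ) *ᵥ ψ)).re := by
    rw [hubbardTorus_eq_zero_add_smul_interaction U, add_mulVec, Matrix.smul_mulVec, dotProduct_add,
      dotProduct_smul, smul_eq_mul, Complex.add_re, Complex.re_ofReal_mul]
  -- the free variational principle for `ψ`
  have hH0 : (hubbardTorus 2 L 1 0).IsHermitian := LiebThm1.hamiltonian_isHermitian _ 1 0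
  have hkin := minEnergyOn_le_rayleigh_of_mem hH0 _ hmem h1
  refine ⟨?_, hkin⟩
  rw [← hsplit, hE]
  exact hvar

/-- **KINETIC EXCESS OF A SECTOR GROUND STATE IS AT MOST `U n²/L²`.** For `U ≥ 0`, `L ≥ 3` and a normalised
ground state `ψ` of the `(2n, S^z = 0)` sector of `hubbardTorus 2 L 1 U`:
`Re⟨ψ, H₀ψ⟩ - minEnergyOn H₀ (szSector (2n) 0) ≤ U n²/L²` (paired Fermi sea as competitor, `⟨D⟩_ψ ≥ 0`).
Penn (1966) §II; Tasaki (2020) §2.2. [folklore] -/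
theorem kineticExcess_le_of_groundStateInSector (hL : 3 ≤ L) {U : ℝ} (hU : 0 ≤ U) {n : ℕ}
    {ψ : Fock (Orb (FermionTorus 2 L))} (hψ : IsGroundStateInSector (hubbardTorus 2 L 1 U) (2 * n) 0 ψ)
    (h1 : star ψ ⬝ᵥ ψ = 1) :
    (star ψ ⬝ᵥ (hubbardTorus 2 L 1 0 *ᵥ ψ)).re -
        (hubbardTorus 2 L 1 0).minEnergyOn (szSector (Λ := FermionTorus 2 L) (2 * n) 0) ≤
      U * ((n : ℝ) ^ 2 / (L : ℝ) ^ 2) := by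
  obtain ⟨h, -⟩ := re_expect_add_interaction_le_of_groundStateInSector hL hψ h1
  have hD := (re_expect_interaction_torus_mem_Icc ψ).1
  nlinarith [mul_nonneg hU hD]

/-- **THE DOUBLON DENSITY OF A SECTOR GROUND STATE IS AT MOST THE UNCORRELATED VALUE**: for `U > 0`,
`L ≥ 3` and a normalised ground state `ψ` of the `(2n, S^z = 0)` sector of `hubbardTorus 2 L 1 U`,
`Re⟨ψ, Σ_x n_x↑ n_x↓ ψ⟩ ≤ n²/L²` (`= L² · (n/L²)²`, the Hartree–Fock value of the paramagnetic sea).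
Penn (1966) §II. [folklore] -/
theorem re_expect_interaction_le_of_groundStateInSector (hL : 3 ≤ L) {U : ℝ} (hU : 0 < U) {n : ℕ}
    {ψ : Fock (Orb (FermionTorus 2 L))} (hψ : IsGroundStateInSector (hubbardTorus 2 L 1 U) (2 * n) 0 ψ)
    (h1 : star ψ ⬝ᵥ ψ = 1) :
    (star ψ ⬝ᵥ ((∑ x : FermionTorus 2 L, numberOp x 0 * numberOp x 1 :
        Matrix (Finset (Orb (FermionTorus 2 L))) _ ℂ) *ᵥ ψ)).re ≤ (n : ℝ) ^ 2 / (L : ℝ) ^ 2 := by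
  obtain ⟨h, hkin⟩ := re_expect_add_interaction_le_of_groundStateInSector hL hψ h1
  have hUD : U * (star ψ ⬝ᵥ ((∑ x : FermionTorus 2 L, numberOp x 0 * numberOp x 1 :
      Matrix (Finset (Orb (FermionTorus 2 L))) _ ℂ) *ᵥ ψ)).re ≤ U * ((n : ℝ) ^ 2 / (L : ℝ) ^ 2) := by
    linarith
  exact le_of_mul_le_mul_left hUD hU

/-- **Bloch occupations of a sector ground state deviate from the Fermi step only in a shell of weight
`U n²/L²`**: for `U ≥ 0`, `L ≥ 3` and a normalised ground state `ψ` of the `(2n, S^z = 0)` sector of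
`hubbardTorus 2 L 1 U` there is a Fermi level `ε_F` with
`Σ_k |ε_L(k) - ε_F| · x_k (1 - x_k) ≤ U n²/L²`, `x_k = Re⟨ψ, n_{k↑}ψ⟩`
(`sum_abs_sub_fermiLevel_mul_le_energy_excess` + `kineticExcess_le_of_groundStateInSector`). [folklore] -/
theorem sum_abs_sub_fermiLevel_mul_le_of_groundStateInSector (hL : 3 ≤ L) {U : ℝ} (hU : 0 ≤ U) {n : ℕ}
    {ψ : Fock (Orb (FermionTorus 2 L))} (hψ : IsGroundStateInSector (hubbardTorus 2 L 1 U) (2 * n) 0 ψ)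
    (h1 : star ψ ⬝ᵥ ψ = 1) :
    ∃ eF : ℝ, ∑ k : TorusSite 2 L, |torusBand L k - eF| *
        ((star ψ ⬝ᵥ (momentumNumber k 0 *ᵥ ψ)).re * (1 - (star ψ ⬝ᵥ (momentumNumber k 0 *ᵥ ψ)).re)) ≤
      U * ((n : ℝ) ^ 2 / (L : ℝ) ^ 2) := by
  obtain ⟨eF, h⟩ := sum_abs_sub_fermiLevel_mul_le_energy_excess hL hψ.1 h1
  exact ⟨eF, h.trans (kineticExcess_le_of_groundStateInSector hL hU hψ h1)⟩

end Literature.MathematicalPhysics.QuantumLattice
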